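import Literature.Barriers.CriticalPhenomena.WeaklySAWPerturbativePi
import HarnessLib

/-!
# BBS-rg-pt, Lemma 6.1.2 for `ξ_j = L^{2(j+1)}ξ'_j`, `ξ' = 4(δ[w^{(3)}] - 3w^{(2)}C_{0,0}) + ¼βη'`, of
# the weakly self-avoiding walk (`d = 4`): the Wick-ordered cubic coefficient is `O(ϑ_j)`

Companion of `WeaklySAWPerturbativeCoefficients.lean` (`xiPrimePT`, `xiPT`), of
`WeaklySAWPerturbativeEtaTheta.lean` / `WeaklySAWPerturbativePi.lean` (the counting, the second
differences `|∇²C_{j+1}| ≤ cϑ_j/L^{4j}`) and of the tree's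
`RigorousRGSmallParameterPerturbativeCoefficientsXi.lean`, whose discrete calculus on `ℤ^d`
(`PT.abs_symmDiff_le`: `|f(x) + f(-x) - 2f(0)| ≤ |x|₁²sup|∇²f|`; `PT.sum_even_mul_sub_eq`: against an
even weight the linear Taylor term drops out) organises the same estimate for the long-range model.
Source of the estimate: R. Bauerschmidt, D. C. Brydges, G. Slade, *A renormalisation group method.
III. Perturbative analysis*, J. Stat. Phys. **159** (2015), arXiv:1403.7252 [BBS-rg-pt], Lemma 6.1.2
(`ξ'_j = O(L^{-(d-2)j}(1+m²L^{2j})^{-k})`), quoted by Bauerschmidt–Brydges–Slade, CMP 337 (2015)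
[BBS2015], §6.1 as Assumption (A2) (`ξ_j = O(χ_j)`). The proof is the one printed for the same
coefficient in the companion 4-d `|φ|⁴` paper / Slade §10.2 ("(10.30) `δ[w^{(3)}] - 3w^{(2)}C_{j+1;0,0}
= 3((w_j²C_{j+1})^{(1)} - w_j^{(2)}C_{j+1;0,0}) + 3(w_jC_{j+1}²)^{(1)} + C_{j+1}^{(3)}` … the identity
(which follows from `w_{-x}² = w_x²`) … `|C_{j+1;0,x} - C_{j+1;0,0} - Σ_ix_i(∇^{e_i}C)_0| ≲
|x|²‖∇²C_{j+1}‖_∞` … `Σ_xδ_k[w_x²]|x|² ≲ L^{2k}Σ_xδ_k[w_x²]`"), at `d = 4`.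

## What this file proves (everything; no definition, no named fact), `d = 4`, `L ≥ 2`

* `xiPrimePT_decomposition` — (10.30) for the explicit decomposition, as finite sums;
* `sum_abs_covSum_sq_succ_sub_le` (`Σ_x|w_{k+1,x}² - w_{k,x}²| ≤ 80c²L⁴`), `sum_covSum_sq_mul_l1_sq_le`
  (`Σ_xw_{j,x}²|x|₁² ≤ 40c²L⁶L^{2j}`, telescoping over `k`), `sum_abs_covSum_le` (`Σ_x|w_{j,x}| ≤ 32cL⁴L^{2j}`),
  `abs_latGrad_two_Gam_four_le(_decay)` (`|∇^e∇^{e'}C_{j+1}| ≤ c(ϑ_j)/L^{4j}`);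
* `abs_xiPT_le_core` — `|ξ_j|` in terms of sup bounds `A` on `C_{j+1}`, `G₂` on `∇²C_{j+1}` and `Bβ` on `β_j`;
* **`abs_xiPT_le`**, **`abs_xiPT_le_decay`** — `|ξ_j| ≤ KL¹⁰` for all `m² ≥ 0`, `j`, and
  `|ξ_j| ≤ KL¹⁰ϑ_j` for `m² > 0` (`ϑ_j = (1+L^{2j}m²/(8+m²))^{-p}`, every `p`).
-/

noncomputable section

open Set Filter Topology
open Literature.Probability.LatticeModels
open scoped BigOperators

namespace Literature.Barriers.CriticalPhenomena

namespace CTWSAW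

open LongRangePhi4 LongRangePhi4.FRD PT

/-! ### (10.30) for the explicit decomposition -/

/-- **(10.30):** `δ[w^{(3)}] - 3w^{(2)}C_{j+1;0,0} = 3Σ_xw_j²(C_{j+1,x} - C_{j+1,0}) + 3Σ_xw_jC_{j+1}² +
Σ_xC_{j+1}³`, as finite sums over `|x|₁ < ½L^{j+1}` (`d ≥ 1`, `L ≥ 1`, `m² ≥ 0`).
[cite: BauerschmidtBrydgesSlade2015LogCorr, §6.1 ([BBS-rg-pt] §3.6 (xipidef) and Lemma 6.1.2; Slade2017 §10.2 display (10.30))] -/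
theorem xiPrimePT_decomposition {d : ℕ} (hd : 1 ≤ d) {L : ℝ} (hL : 1 ≤ L) {s : ℝ} (hs : 0 ≤ s) (j : ℕ) :
    powSum (covSum d L s (j + 1)) 3 - powSum (covSum d L s j) 3 -
        3 * powSum (covSum d L s j) 2 * Gam d L s (j + 1) 0 =
      3 * ∑ x ∈ PT.ball (L ^ (j + 1) / 2), covSum d L s j x ^ 2 * (Gam d L s (j + 1) x - Gam d L s (j + 1) 0) +
      3 * ∑ x ∈ PT.ball (L ^ (j + 1) / 2), covSum d L s j x * Gam d L s (j + 1) x ^ 2 +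
      ∑ x ∈ PT.ball (L ^ (j + 1) / 2), Gam d L s (j + 1) x ^ 3 := by
  set S := PT.ball (d := d) (L ^ (j + 1) / 2) with hS
  have hsupp : ∀ i ≤ j + 1, ∀ x ∉ S, covSum d L s i x = 0 := by
    intro i hi x hx
    rw [hS, PT.mem_ball, not_lt] at hx
    have hpow : L ^ i / 2 ≤ L ^ (j + 1) / 2 :=
      div_le_div_of_nonneg_right (pow_le_pow_right₀ hL hi) (by norm_num)
    exact covSum_eq_zero hd hL hs (hpow.trans hx)
  have h3 : powSum (covSum d L s (j + 1)) 3 = ∑ x ∈ S, covSum d L s (j + 1) x ^ 3 :=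
    powSum_eq_sum (hsupp (j + 1) le_rfl) (by norm_num)
  have h3' : powSum (covSum d L s j) 3 = ∑ x ∈ S, covSum d L s j x ^ 3 :=
    powSum_eq_sum (hsupp j (Nat.le_succ j)) (by norm_num)
  have h2 : powSum (covSum d L s j) 2 = ∑ x ∈ S, covSum d L s j x ^ 2 :=
    powSum_eq_sum (hsupp j (Nat.le_succ j)) (by norm_num)
  set w := covSum d L s j with hw
  set C := Gam d L s (j + 1) with hC
  have hA : ∑ x ∈ S, covSum d L s (j + 1) x ^ 3 = ∑ x ∈ S, w x ^ 3 + 3 * ∑ x ∈ S, w x ^ 2 * C x +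
      3 * ∑ x ∈ S, w x * C x ^ 2 + ∑ x ∈ S, C x ^ 3 := by
    have e : ∀ x ∈ S, covSum d L s (j + 1) x ^ 3 =
        w x ^ 3 + 3 * (w x ^ 2 * C x) + 3 * (w x * C x ^ 2) + C x ^ 3 := by
      intro x _; rw [covSum_succ]; ring
    rw [Finset.sum_congr rfl e]
    simp only [Finset.sum_add_distrib, ← Finset.mul_sum]
  have hB : ∑ x ∈ S, w x ^ 2 * (C x - C 0) = ∑ x ∈ S, w x ^ 2 * C x - (∑ x ∈ S, w x ^ 2) * C 0 := by
    rw [Finset.sum_mul, ← Finset.sum_sub_distrib]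
    exact Finset.sum_congr rfl fun x _ => by ring
  rw [h3, h3', h2, hA, hB]
  ring

/-! ### Auxiliary sums over `w_j` -/

/-- **`Σ_x|w_{k+1,x}² - w_{k,x}²| ≤ 80c²L⁴`** for every finite set of sites, all `m² ≥ 0`, `k` (the
counting of `BBS2015_A1_bounded`). [cite: BauerschmidtBrydgesSlade2015LogCorr, §6.1 (β_j; the same counting)] -/
theorem sum_abs_covSum_sq_succ_sub_le {c : ℝ} (hc0 : 0 < c)
    (hc : ∀ L : ℝ, 2 ≤ L → ∀ s : ℝ, 0 ≤ s → ∀ i : ℕ, ∀ x : Site 4, |Gam 4 L s (i + 1) x| ≤ c / L ^ (2 * i))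
    {L : ℝ} (hL : 2 ≤ L) {s : ℝ} (hs : 0 ≤ s) (k : ℕ) (S : Finset (Site 4)) :
    ∑ x ∈ S, |covSum 4 L s (k + 1) x ^ 2 - covSum 4 L s k x ^ 2| ≤ 80 * c ^ 2 * L ^ 4 := by
  classical
  have hL1 : (1 : ℝ) ≤ L := by linarith
  have hL0 : (0 : ℝ) < L := by linarith
  set a : ℕ → ℝ := fun i => c / L ^ (2 * i) with ha
  set ind : ℕ → Site 4 → ℝ := fun i x => if x ∈ PT.ball (L ^ (i + 1) / 2) then (1 : ℝ) else 0 with hind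
  have ha0 : ∀ i, 0 ≤ a i := fun i => by simp only [ha]; positivity
  have hGi : ∀ x, |Gam 4 L s (k + 1) x| ≤ a k * ind k x := by
    intro x
    simp only [hind]
    split_ifs with hx
    · rw [mul_one]; exact hc L hL s hs k x
    · rw [mul_zero, PT.mem_ball, not_lt] at *
      rw [Gam_eq_zero (by norm_num) hL0.le hs (k + 1) x hx, abs_zero]
  have hW : ∀ x, |covSum 4 L s k x| ≤ ∑ i ∈ Finset.range k, a i * ind i x := fun x =>
    abs_covSum_four_le hc hL hs k x
  have hpt : ∀ x, |covSum 4 L s (k + 1) x ^ 2 - covSum 4 L s k x ^ 2| ≤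
      a k * (2 * ∑ i ∈ Finset.range k, a i * (ind i x * ind k x)) + a k * (a k * ind k x) := by
    intro x
    rw [covSum_succ]
    have e : (covSum 4 L s k x + Gam 4 L s (k + 1) x) ^ 2 - covSum 4 L s k x ^ 2 =
        Gam 4 L s (k + 1) x * (2 * covSum 4 L s k x) + Gam 4 L s (k + 1) x ^ 2 := by ring
    rw [e]
    have hind0 : 0 ≤ ind k x := by simp only [hind]; split_ifs <;> norm_num
    have hind1 : ind k x ≤ 1 := by simp only [hind]; split_ifs <;> norm_num
    have hindsq : ind k x * ind k x = ind k x := by simp only [hind]; split_ifs <;> norm_num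
    refine (abs_add_le _ _).trans (add_le_add ?_ ?_)
    · rw [abs_mul, abs_mul, abs_two]
      calc |Gam 4 L s (k + 1) x| * (2 * |covSum 4 L s k x|)
          ≤ a k * ind k x * (2 * ∑ i ∈ Finset.range k, a i * ind i x) :=
            mul_le_mul (hGi x) (by linarith [hW x]) (by positivity) (mul_nonneg (ha0 k) hind0)
        _ = a k * (2 * ∑ i ∈ Finset.range k, a i * (ind i x * ind k x)) := by
            rw [Finset.mul_sum, Finset.mul_sum, Finset.mul_sum, Finset.mul_sum]
            refine Finset.sum_congr rfl fun i _ => by ring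
    · rw [abs_pow, sq]
      calc |Gam 4 L s (k + 1) x| * |Gam 4 L s (k + 1) x| ≤ a k * ind k x * (a k * ind k x) :=
            mul_le_mul (hGi x) (hGi x) (abs_nonneg _) (mul_nonneg (ha0 k) hind0)
        _ = a k * (a k * (ind k x * ind k x)) := by ring
        _ = a k * (a k * ind k x) := by rw [hindsq]
  refine (Finset.sum_le_sum fun x _ => hpt x).trans ?_
  rw [Finset.sum_add_distrib, ← Finset.mul_sum, ← Finset.mul_sum, ← Finset.mul_sum, ← Finset.mul_sum,
    Finset.sum_comm]
  have hS1 : ∑ i ∈ Finset.range k, ∑ x ∈ S, a i * (ind i x * ind k x) ≤ 16 * c * L ^ 4 * (2 * L ^ (2 * k)) := by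
    have hai : ∀ i, a i * (16 * L ^ 4 * L ^ (4 * i)) = 16 * c * L ^ 4 * L ^ (2 * i) := by
      intro i
      simp only [ha]
      have : L ^ (4 * i) = L ^ (2 * i) * L ^ (2 * i) := by rw [← pow_add]; ring_nf
      rw [this]; field_simp
    have hindk0 : ∀ x, 0 ≤ ind k x := fun x => by simp only [hind]; split_ifs <;> norm_num
    have hindk1 : ∀ x, ind k x ≤ 1 := fun x => by simp only [hind]; split_ifs <;> norm_num
    have hindi0 : ∀ i x, 0 ≤ ind i x := fun i x => by simp only [hind]; split_ifs <;> norm_num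
    have hin : ∀ i ∈ Finset.range k, ∑ x ∈ S, a i * (ind i x * ind k x) ≤ 16 * c * L ^ 4 * L ^ (2 * i) := by
      intro i _
      rw [← Finset.mul_sum, ← hai i]
      refine mul_le_mul_of_nonneg_left ?_ (ha0 i)
      calc ∑ x ∈ S, ind i x * ind k x ≤ ∑ x ∈ S, ind i x :=
            Finset.sum_le_sum fun x _ => mul_le_of_le_one_right (hindi0 i x) (hindk1 x)
        _ ≤ 16 * L ^ 4 * L ^ (4 * i) := sum_ball_indicator_le S hL1 i
    refine (Finset.sum_le_sum hin).trans ?_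
    rw [← Finset.mul_sum]
    exact mul_le_mul_of_nonneg_left (geom_sum_sq_le hL k) (by positivity)
  have hS2 : ∑ x ∈ S, ind k x ≤ 16 * L ^ 4 * L ^ (4 * k) := sum_ball_indicator_le S hL1 k
  have hak : a k * L ^ (2 * k) = c := by simp only [ha]; field_simp
  have hak2 : a k * (a k * L ^ (4 * k)) = c ^ 2 := by
    simp only [ha]
    rw [show 4 * k = 2 * k + 2 * k by ring, pow_add]
    field_simp
  calc a k * (2 * ∑ i ∈ Finset.range k, ∑ x ∈ S, a i * (ind i x * ind k x)) + a k * (a k * ∑ x ∈ S, ind k x)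
      ≤ a k * (2 * (16 * c * L ^ 4 * (2 * L ^ (2 * k)))) + a k * (a k * (16 * L ^ 4 * L ^ (4 * k))) := by
        gcongr
    _ = 64 * c * L ^ 4 * (a k * L ^ (2 * k)) + 16 * L ^ 4 * (a k * (a k * L ^ (4 * k))) := by ring
    _ = 80 * c ^ 2 * L ^ 4 := by rw [hak, hak2]; ring

/-- **`Σ_xw_{j,x}²|x|₁² ≤ 40c²L⁶L^{2j}`** (every finite set of sites; all `m² ≥ 0`): "we write
`w_{j,x}² = Σ_{k<j}δ_k[w_x²]`", `Σ_x|δ_k[w_x²]||x|₁² ≤ (½L^{k+1})²Σ_x|δ_k[w_x²]| ≤ 20c²L⁶L^{2k}`, and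
`Σ_{k<j}L^{2k} ≤ 2L^{2j}`. [cite: BauerschmidtBrydgesSlade2015LogCorr, §6.1 ([BBS-rg-pt] Lemma 6.1.2; Slade2017 §10.2 displays (10.33), (10.36))] -/
theorem sum_covSum_sq_mul_l1_sq_le {c : ℝ} (hc0 : 0 < c)
    (hc : ∀ L : ℝ, 2 ≤ L → ∀ s : ℝ, 0 ≤ s → ∀ i : ℕ, ∀ x : Site 4, |Gam 4 L s (i + 1) x| ≤ c / L ^ (2 * i))
    {L : ℝ} (hL : 2 ≤ L) {s : ℝ} (hs : 0 ≤ s) (j : ℕ) (S : Finset (Site 4)) :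
    ∑ x ∈ S, covSum 4 L s j x ^ 2 * (l1N x : ℝ) ^ 2 ≤ 40 * c ^ 2 * L ^ 6 * L ^ (2 * j) := by
  have hL1 : (1 : ℝ) ≤ L := by linarith
  have hL0 : (0 : ℝ) < L := by linarith
  set δ : ℕ → Site 4 → ℝ := fun k x => covSum 4 L s (k + 1) x ^ 2 - covSum 4 L s k x ^ 2 with hδ
  have htel : ∀ x, covSum 4 L s j x ^ 2 = ∑ k ∈ Finset.range j, δ k x := by
    intro x
    rw [Finset.sum_range_sub (fun k => covSum 4 L s k x ^ 2), covSum_zero]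
    ring
  have hpt : ∀ k x, |δ k x| * (l1N x : ℝ) ^ 2 ≤ (L ^ (k + 1) / 2) ^ 2 * |δ k x| := by
    intro k x
    by_cases hx : x ∈ PT.ball (L ^ (k + 1) / 2)
    · rw [PT.mem_ball] at hx
      rw [mul_comm]
      have h0 : (0 : ℝ) ≤ (l1N x : ℝ) := Nat.cast_nonneg _
      have : (l1N x : ℝ) ^ 2 ≤ (L ^ (k + 1) / 2) ^ 2 := pow_le_pow_left₀ h0 (le_of_lt hx) 2
      exact mul_le_mul_of_nonneg_right this (abs_nonneg _)
    · have : δ k x = 0 := by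
        simp only [hδ]
        rw [PT.mem_ball, not_lt] at hx
        have hk : L ^ k / 2 ≤ L ^ (k + 1) / 2 :=
          div_le_div_of_nonneg_right (pow_le_pow_right₀ hL1 (Nat.le_succ k)) (by norm_num)
        rw [covSum_eq_zero (by norm_num) hL1 hs hx, covSum_eq_zero (by norm_num) hL1 hs (hk.trans hx)]
        ring
      rw [this, abs_zero]; simp
  have hk : ∀ k, ∑ x ∈ S, |δ k x| * (l1N x : ℝ) ^ 2 ≤ 20 * c ^ 2 * L ^ 6 * L ^ (2 * k) := by
    intro k
    have hD := sum_abs_covSum_sq_succ_sub_le hc0 hc hL hs k S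
    calc ∑ x ∈ S, |δ k x| * (l1N x : ℝ) ^ 2 ≤ ∑ x ∈ S, (L ^ (k + 1) / 2) ^ 2 * |δ k x| :=
          Finset.sum_le_sum fun x _ => hpt k x
      _ = (L ^ (k + 1) / 2) ^ 2 * ∑ x ∈ S, |δ k x| := by rw [Finset.mul_sum]
      _ ≤ (L ^ (k + 1) / 2) ^ 2 * (80 * c ^ 2 * L ^ 4) := mul_le_mul_of_nonneg_left hD (by positivity)
      _ = 20 * c ^ 2 * L ^ 6 * L ^ (2 * k) := by ring
  calc ∑ x ∈ S, covSum 4 L s j x ^ 2 * (l1N x : ℝ) ^ 2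
      = ∑ x ∈ S, ∑ k ∈ Finset.range j, δ k x * (l1N x : ℝ) ^ 2 := by
        refine Finset.sum_congr rfl fun x _ => ?_
        rw [htel x, Finset.sum_mul]
    _ = ∑ k ∈ Finset.range j, ∑ x ∈ S, δ k x * (l1N x : ℝ) ^ 2 := Finset.sum_comm
    _ ≤ ∑ k ∈ Finset.range j, ∑ x ∈ S, |δ k x| * (l1N x : ℝ) ^ 2 :=
        Finset.sum_le_sum fun k _ => Finset.sum_le_sum fun x _ =>
          mul_le_mul_of_nonneg_right (le_abs_self _) (by positivity)
    _ ≤ ∑ k ∈ Finset.range j, 20 * c ^ 2 * L ^ 6 * L ^ (2 * k) := Finset.sum_le_sum fun k _ => hk k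
    _ = 20 * c ^ 2 * L ^ 6 * ∑ k ∈ Finset.range j, L ^ (2 * k) := by rw [Finset.mul_sum]
    _ ≤ 20 * c ^ 2 * L ^ 6 * (2 * L ^ (2 * j)) := mul_le_mul_of_nonneg_left (geom_sum_sq_le hL j) (by positivity)
    _ = 40 * c ^ 2 * L ^ 6 * L ^ (2 * j) := by ring

/-- **`Σ_x|w_{j,x}| ≤ 32cL⁴L^{2j}`** (every finite set of sites; all `m² ≥ 0`).
[cite: BauerschmidtBrydgesSlade2015LogCorr, §6.1 ([BBS-rg-pt] Lemma 6.1.2, bound on w^{(1)}: O(L^{2j}))] -/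
theorem sum_abs_covSum_le {c : ℝ} (hc0 : 0 < c)
    (hc : ∀ L : ℝ, 2 ≤ L → ∀ s : ℝ, 0 ≤ s → ∀ i : ℕ, ∀ x : Site 4, |Gam 4 L s (i + 1) x| ≤ c / L ^ (2 * i))
    {L : ℝ} (hL : 2 ≤ L) {s : ℝ} (hs : 0 ≤ s) (j : ℕ) (S : Finset (Site 4)) :
    ∑ x ∈ S, |covSum 4 L s j x| ≤ 32 * c * L ^ 4 * L ^ (2 * j) := by
  classical
  have hL1 : (1 : ℝ) ≤ L := by linarith
  have hL0 : (0 : ℝ) < L := by linarith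
  set a : ℕ → ℝ := fun i => c / L ^ (2 * i) with ha
  set ind : ℕ → Site 4 → ℝ := fun i x => if x ∈ PT.ball (L ^ (i + 1) / 2) then (1 : ℝ) else 0 with hind
  have ha0 : ∀ i, 0 ≤ a i := fun i => by simp only [ha]; positivity
  refine (Finset.sum_le_sum fun x _ => abs_covSum_four_le hc hL hs j x).trans ?_
  rw [Finset.sum_comm]
  have hai : ∀ i, a i * (16 * L ^ 4 * L ^ (4 * i)) = 16 * c * L ^ 4 * L ^ (2 * i) := by
    intro i
    simp only [ha]
    have : L ^ (4 * i) = L ^ (2 * i) * L ^ (2 * i) := by rw [← pow_add]; ring_nf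
    rw [this]; field_simp
  have hin : ∀ i ∈ Finset.range j, ∑ x ∈ S, a i * ind i x ≤ 16 * c * L ^ 4 * L ^ (2 * i) := by
    intro i _
    rw [← Finset.mul_sum, ← hai i]
    exact mul_le_mul_of_nonneg_left (sum_ball_indicator_le _ hL1 i) (ha0 i)
  refine (Finset.sum_le_sum hin).trans ?_
  rw [← Finset.mul_sum]
  have := geom_sum_sq_le hL j
  have k0 : 0 ≤ 16 * c * L ^ 4 := by positivity
  nlinarith [mul_le_mul_of_nonneg_left this k0]

/-! ### Second differences of `C_{j+1}` along unit steps -/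

/-- **`|∇^e∇^{e'}C_{j+1;0,x}| ≤ cϑ_j/L^{4j}`** for unit steps `e, e'`, `m² = s > 0` (`d = 4`, every `p`).
[cite: BauerschmidtBrydgesSlade2015LogCorr, §5.2 (scaling estimate with |α|₁ = 2, d = 4)] -/
theorem abs_latGrad_two_Gam_four_le_decay (p : ℕ) : ∃ c : ℝ, 0 < c ∧ ∀ L : ℝ, 2 ≤ L → ∀ s : ℝ, 0 < s →
    ∀ j : ℕ, ∀ e e' : Site 4, IsUnitStep e → IsUnitStep e' → ∀ x : Site 4,
      |latGrad [e, e'] (Gam 4 L s (j + 1)) x| ≤ c * ((1 + L ^ (2 * j) * s / (8 + s)) ^ p)⁻¹ / L ^ (4 * j) := by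
  obtain ⟨c, hc, h⟩ := abs_latGrad_Gam_le_of_three_le (d := 4) (by norm_num) 2 p (by norm_num)
  refine ⟨c, hc, fun L hL s hs j e e' he he' x => ?_⟩
  have hL0 : (0 : ℝ) < L := by linarith
  have hl : ∀ f ∈ [e, e'], (∑ k, |((f k : ℤ) : ℝ)|) ≤ 1 := by
    intro f hf
    simp only [List.mem_cons, List.mem_nil_iff, or_false] at hf
    rcases hf with rfl | rfl
    · exact he.sum_abs_le
    · exact he'.sum_abs_le
  have := h _ (by simp) hl L hL s hs (j + 1) (by omega) x
  rw [Nat.add_sub_cancel] at this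
  refine this.trans ?_
  have e2 : (L ^ j) ^ 2 = L ^ (2 * j) := by rw [← pow_mul, mul_comm]
  have e6 : (L ^ j) ^ 2 / (L ^ j) ^ (4 + 2) = 1 / L ^ (4 * j) := by
    rw [show (4 + 2 : ℕ) = 2 + 4 by norm_num, pow_add, div_mul_eq_div_div,
      div_self (pow_ne_zero _ (pow_ne_zero _ hL0.ne')), ← pow_mul, mul_comm j 4]
  rw [e6, e2, show (2 * ((4 : ℕ) : ℝ) + s) = 8 + s by norm_num]
  have hfrac : 1 / (8 + s) ≤ 1 := by rw [div_le_one (by positivity)]; linarith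
  set ϑ : ℝ := ((1 + L ^ (2 * j) * s / (8 + s)) ^ p)⁻¹
  have hϑ0 : 0 ≤ ϑ := by positivity
  calc c * (1 / (8 + s) * ϑ) * (1 / L ^ (4 * j)) ≤ c * (1 * ϑ) * (1 / L ^ (4 * j)) := by gcongr
    _ = c * ϑ / L ^ (4 * j) := by ring

/-- **`|∇^e∇^{e'}C_{j+1;0,x}| ≤ c/L^{4j}`** for unit steps and all `m² ≥ 0` (right-continuity at `0`).
[cite: BauerschmidtBrydgesSlade2015LogCorr, §5.2 (scaling estimate, |α|₁ = 2) and §6.1 ([BBS-rg-pt] Lemma 6.1.2, (Cconcl), l = 2)] -/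
theorem abs_latGrad_two_Gam_four_le : ∃ c : ℝ, 0 < c ∧ ∀ L : ℝ, 2 ≤ L → ∀ s : ℝ, 0 ≤ s →
    ∀ j : ℕ, ∀ e e' : Site 4, IsUnitStep e → IsUnitStep e' → ∀ x : Site 4,
      |latGrad [e, e'] (Gam 4 L s (j + 1)) x| ≤ c / L ^ (4 * j) := by
  obtain ⟨c, hc, h⟩ := abs_latGrad_two_Gam_four_le_decay 0
  refine ⟨c, hc, fun L hL s hs j e e' he he' x => ?_⟩
  have hpos : ∀ s : ℝ, 0 < s → |latGrad [e, e'] (Gam 4 L s (j + 1)) x| ≤ c / L ^ (4 * j) := by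
    intro s hs
    simpa using h L hL s hs j e e' he he' x
  rcases hs.lt_or_eq with hs' | hs'
  · exact hpos s hs'
  · rw [← hs']
    have hL0 : (0 : ℝ) ≤ L := by linarith
    have hT : Tendsto (fun s => latGrad [e, e'] (Gam 4 L s (j + 1)) x) (𝓝[>] 0)
        (𝓝 (latGrad [e, e'] (Gam 4 L 0 (j + 1)) x)) := by
      simp only [latGrad_cons, latGrad_nil]
      exact ((tendsto_Gam_mass (by norm_num) hL0 _ _).sub (tendsto_Gam_mass (by norm_num) hL0 _ _)).sub
        ((tendsto_Gam_mass (by norm_num) hL0 _ _).sub (tendsto_Gam_mass (by norm_num) hL0 _ _))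
    refine le_of_tendsto ((continuous_abs.tendsto _).comp hT) ?_
    filter_upwards [self_mem_nhdsWithin] with s hs using hpos s hs

/-! ### The bound on `ξ_j` -/

/-- **The core bound on `ξ_j`** (`d = 4`, `L ≥ 2`, `m² = s ≥ 0`): if `|C_{j+1;0,x}| ≤ A`,
`|∇^e∇^{e'}C_{j+1}| ≤ G₂` (unit steps) and `|β_j| ≤ Bβ`, then
`|ξ_j| ≤ L^{2(j+1)}(4(3·½G₂·40c²L⁶L^{2j} + 3A²·32cL⁴L^{2j} + A³·16L⁴L^{4j}) + ¼Bβ·2A)` — the Wick term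
by `PT.sum_even_mul_sub_eq` + `PT.abs_symmDiff_le` (evenness of `w_j²`), the others by counting.
[cite: BauerschmidtBrydgesSlade2015LogCorr, §6.1 ([BBS-rg-pt] Lemma 6.1.2: ξ'_j = O(L^{-2j}M_j) at d = 4; Slade2017 §10.2 (10.29)–(10.37))] -/
theorem abs_xiPT_le_core {c : ℝ} (hc0 : 0 < c)
    (hc : ∀ L : ℝ, 2 ≤ L → ∀ s : ℝ, 0 ≤ s → ∀ i : ℕ, ∀ x : Site 4, |Gam 4 L s (i + 1) x| ≤ c / L ^ (2 * i))
    {L : ℝ} (hL : 2 ≤ L) {s : ℝ} (hs : 0 ≤ s) (j : ℕ) {A G₂ Bβ : ℝ} (hA0 : 0 ≤ A) (hG0 : 0 ≤ G₂)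
    (hA : ∀ x : Site 4, |Gam 4 L s (j + 1) x| ≤ A)
    (hG : ∀ e e' : Site 4, IsUnitStep e → IsUnitStep e' → ∀ x : Site 4, |latGrad [e, e'] (Gam 4 L s (j + 1)) x| ≤ G₂)
    (hB : |betaPT 4 L s j| ≤ Bβ) :
    |xiPT 4 L s j| ≤ L ^ (2 * (j + 1)) *
      (4 * (3 * (1 / 2 * G₂ * (40 * c ^ 2 * L ^ 6 * L ^ (2 * j))) + 3 * (A ^ 2 * (32 * c * L ^ 4 * L ^ (2 * j))) +
        A ^ 3 * (16 * L ^ 4 * L ^ (4 * j))) + 1 / 4 * Bβ * (2 * A)) := by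
  have hL1 : (1 : ℝ) ≤ L := by linarith
  have hL0 : (0 : ℝ) < L := by linarith
  set S : Finset (Site 4) := PT.ball (L ^ (j + 1) / 2) with hSdef
  set W : Site 4 → ℝ := covSum 4 L s j
  set G : Site 4 → ℝ := Gam 4 L s (j + 1)
  -- the Wick-ordered term: symmetrise, then second differences
  have hwick : |∑ x ∈ S, W x ^ 2 * (G x - G 0)| ≤ 1 / 2 * G₂ * (40 * c ^ 2 * L ^ 6 * L ^ (2 * j)) := by
    have heven : ∀ x, (fun y => W y ^ 2) (-x) = (fun y => W y ^ 2) x := fun x => by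
      simp only [W, covSum_neg]
    rw [hSdef, sum_even_mul_sub_eq (ω := fun y => W y ^ 2) (f := G) heven, abs_mul,
      abs_of_pos (by norm_num : (0 : ℝ) < 1 / 2)]
    have hsd : ∀ x, |G x + G (-x) - 2 * G 0| ≤ (l1N x : ℝ) ^ 2 * G₂ := fun x =>
      abs_symmDiff_le hG0 (fun e e' he he' y => hG e e' he he' y) x
    have h1 : |∑ x ∈ PT.ball (L ^ (j + 1) / 2), W x ^ 2 * (G x + G (-x) - 2 * G 0)| ≤
        G₂ * ∑ x ∈ PT.ball (L ^ (j + 1) / 2), W x ^ 2 * (l1N x : ℝ) ^ 2 := by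
      refine (Finset.abs_sum_le_sum_abs _ _).trans ?_
      rw [Finset.mul_sum]
      refine Finset.sum_le_sum fun x _ => ?_
      rw [abs_mul, abs_of_nonneg (sq_nonneg _)]
      calc W x ^ 2 * |G x + G (-x) - 2 * G 0| ≤ W x ^ 2 * ((l1N x : ℝ) ^ 2 * G₂) :=
            mul_le_mul_of_nonneg_left (hsd x) (sq_nonneg _)
        _ = G₂ * (W x ^ 2 * (l1N x : ℝ) ^ 2) := by ring
    have h2 := sum_covSum_sq_mul_l1_sq_le hc0 hc hL hs j (PT.ball (L ^ (j + 1) / 2))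
    calc 1 / 2 * |∑ x ∈ PT.ball (L ^ (j + 1) / 2), W x ^ 2 * (G x + G (-x) - 2 * G 0)|
        ≤ 1 / 2 * (G₂ * ∑ x ∈ PT.ball (L ^ (j + 1) / 2), W x ^ 2 * (l1N x : ℝ) ^ 2) :=
          mul_le_mul_of_nonneg_left h1 (by norm_num)
      _ ≤ 1 / 2 * (G₂ * (40 * c ^ 2 * L ^ 6 * L ^ (2 * j))) := by gcongr
      _ = _ := by ring
  -- `(wC²)^{(1)}`
  have hwC2 : |∑ x ∈ S, W x * G x ^ 2| ≤ A ^ 2 * (32 * c * L ^ 4 * L ^ (2 * j)) := by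
    refine (Finset.abs_sum_le_sum_abs _ _).trans ?_
    have hpt : ∀ x ∈ S, |W x * G x ^ 2| ≤ A ^ 2 * |W x| := by
      intro x _
      rw [abs_mul, abs_pow, mul_comm]
      exact mul_le_mul_of_nonneg_right (pow_le_pow_left₀ (abs_nonneg _) (hA x) 2) (abs_nonneg _)
    refine (Finset.sum_le_sum hpt).trans ?_
    rw [← Finset.mul_sum]
    exact mul_le_mul_of_nonneg_left (sum_abs_covSum_le hc0 hc hL hs j S) (sq_nonneg _)
  -- `C^{(3)}`
  have hC3 : |∑ x ∈ S, G x ^ 3| ≤ A ^ 3 * (16 * L ^ 4 * L ^ (4 * j)) := by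
    refine (Finset.abs_sum_le_sum_abs _ _).trans ?_
    have hpt : ∀ x ∈ S, |G x ^ 3| ≤ A ^ 3 := fun x _ => by
      rw [abs_pow]; exact pow_le_pow_left₀ (abs_nonneg _) (hA x) 3
    refine (Finset.sum_le_sum hpt).trans ?_
    rw [Finset.sum_const, nsmul_eq_mul, mul_comm]
    exact mul_le_mul_of_nonneg_left (card_ball_four_le hL1 j) (by positivity)
  -- `¼βη'`
  have hβη : |1 / 4 * betaPT 4 L s j * etaPrimePT 4 L s j| ≤ 1 / 4 * Bβ * (2 * A) := by
    unfold etaPrimePT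
    rw [abs_mul, abs_mul, abs_mul, abs_of_pos (by norm_num : (0 : ℝ) < 1 / 4), abs_two]
    have hB0 : 0 ≤ Bβ := (abs_nonneg _).trans hB
    gcongr
    exact hA 0
  -- assemble `ξ'`
  have hξ' : |xiPrimePT 4 L s j| ≤
      4 * (3 * (1 / 2 * G₂ * (40 * c ^ 2 * L ^ 6 * L ^ (2 * j))) + 3 * (A ^ 2 * (32 * c * L ^ 4 * L ^ (2 * j))) +
        A ^ 3 * (16 * L ^ 4 * L ^ (4 * j))) + 1 / 4 * Bβ * (2 * A) := by
    unfold xiPrimePT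
    rw [xiPrimePT_decomposition (by norm_num) hL1 hs j]
    refine (abs_add_le _ _).trans (add_le_add ?_ hβη)
    rw [abs_mul, show |(4 : ℝ)| = 4 by norm_num]
    refine mul_le_mul_of_nonneg_left ?_ (by norm_num)
    refine (abs_add_le _ _).trans (add_le_add ((abs_add_le _ _).trans (add_le_add ?_ ?_)) hC3)
    · rw [abs_mul, show |(3 : ℝ)| = 3 by norm_num]
      exact mul_le_mul_of_nonneg_left hwick (by norm_num)
    · rw [abs_mul, show |(3 : ℝ)| = 3 by norm_num]
      exact mul_le_mul_of_nonneg_left hwC2 (by norm_num)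
  unfold xiPT
  rw [abs_mul, abs_of_pos (pow_pos hL0 _)]
  exact mul_le_mul_of_nonneg_left hξ' (pow_pos hL0 _).le

/-- **`|ξ_j| ≤ KL¹⁰`** for all `m² ≥ 0`, `j` (`d = 4`, `L ≥ 2`).
[cite: BauerschmidtBrydgesSlade2015LogCorr, §6.1 (Assumption (A2) for ξ_j; [BBS-rg-pt] Lemma 6.1.2: ξ_j = L^{2(j+1)}ξ'_j = O(1) at d = 4)] -/
theorem abs_xiPT_le : ∃ K : ℝ, 0 < K ∧ ∀ L : ℝ, 2 ≤ L → ∀ s : ℝ, 0 ≤ s → ∀ j : ℕ,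
    |xiPT 4 L s j| ≤ K * L ^ 10 := by
  obtain ⟨c, hc, h⟩ := abs_Gam_four_le
  obtain ⟨c₂, hc₂, h₂⟩ := abs_latGrad_two_Gam_four_le
  obtain ⟨Kb, hKb, hb⟩ := BBS2015_A1_bounded
  refine ⟨4 * (60 * c₂ * c ^ 2 + 96 * c ^ 3 + 16 * c ^ 3) + 1 / 2 * Kb * c, by positivity,
    fun L hL s hs j => ?_⟩
  have hL0 : (0 : ℝ) < L := by linarith
  have hL1 : (1 : ℝ) ≤ L := by linarith
  have hA0 : 0 ≤ c / L ^ (2 * j) := by positivity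
  have hG0 : 0 ≤ c₂ / L ^ (4 * j) := by positivity
  have := abs_xiPT_le_core hc h hL hs j hA0 hG0 (fun x => h L hL s hs j x)
    (fun e e' he he' x => h₂ L hL s hs j e e' he he' x) (hb L hL s hs j)
  refine this.trans ?_
  -- bookkeeping of the powers of `L`
  have hp2 : (0 : ℝ) < L ^ (2 * j) := pow_pos hL0 _
  have e1 : L ^ (2 * (j + 1)) * (1 / 2 * (c₂ / L ^ (4 * j)) * (40 * c ^ 2 * L ^ 6 * L ^ (2 * j))) =
      20 * c₂ * c ^ 2 * L ^ 8 := by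
    rw [show 4 * j = 2 * j + 2 * j by ring, pow_add, show 2 * (j + 1) = 2 * j + 2 by ring, pow_add]
    field_simp
    norm_num
  have e2 : L ^ (2 * (j + 1)) * ((c / L ^ (2 * j)) ^ 2 * (32 * c * L ^ 4 * L ^ (2 * j))) = 32 * c ^ 3 * L ^ 6 := by
    rw [show 2 * (j + 1) = 2 * j + 2 by ring, pow_add, div_pow, ← pow_mul, show 2 * j * 2 = 2 * j + 2 * j by ring,
      pow_add]
    field_simp
  have e3 : L ^ (2 * (j + 1)) * ((c / L ^ (2 * j)) ^ 3 * (16 * L ^ 4 * L ^ (4 * j))) = 16 * c ^ 3 * L ^ 6 := by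
    rw [show 2 * (j + 1) = 2 * j + 2 by ring, pow_add, div_pow, ← pow_mul,
      show 2 * j * 3 = 2 * j + 4 * j by ring, pow_add]
    field_simp
  have e4 : L ^ (2 * (j + 1)) * (1 / 4 * (Kb * L ^ 4) * (2 * (c / L ^ (2 * j)))) = 1 / 2 * Kb * c * L ^ 6 := by
    rw [show 2 * (j + 1) = 2 * j + 2 by ring, pow_add]
    field_simp
    ring
  have hL6 : L ^ 6 ≤ L ^ 10 := pow_le_pow_right₀ hL1 (by norm_num)
  have hL8 : L ^ 8 ≤ L ^ 10 := pow_le_pow_right₀ hL1 (by norm_num)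
  calc L ^ (2 * (j + 1)) * (4 * (3 * (1 / 2 * (c₂ / L ^ (4 * j)) * (40 * c ^ 2 * L ^ 6 * L ^ (2 * j))) +
        3 * ((c / L ^ (2 * j)) ^ 2 * (32 * c * L ^ 4 * L ^ (2 * j))) +
        (c / L ^ (2 * j)) ^ 3 * (16 * L ^ 4 * L ^ (4 * j))) + 1 / 4 * (Kb * L ^ 4) * (2 * (c / L ^ (2 * j))))
      = 4 * (3 * (20 * c₂ * c ^ 2 * L ^ 8) + 3 * (32 * c ^ 3 * L ^ 6) + 16 * c ^ 3 * L ^ 6) +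
          1 / 2 * Kb * c * L ^ 6 := by
        rw [← e1, ← e2, ← e3, ← e4]; ring
    _ ≤ 4 * (3 * (20 * c₂ * c ^ 2 * L ^ 10) + 3 * (32 * c ^ 3 * L ^ 10) + 16 * c ^ 3 * L ^ 10) +
          1 / 2 * Kb * c * L ^ 10 := by gcongr
    _ = (4 * (60 * c₂ * c ^ 2 + 96 * c ^ 3 + 16 * c ^ 3) + 1 / 2 * Kb * c) * L ^ 10 := by ring

/-- **`|ξ_j| ≤ KL¹⁰(1+L^{2j}m²/(8+m²))^{-p}`** for `m² > 0` (every `p`): `ξ_j = O(χ_j)`.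
[cite: BauerschmidtBrydgesSlade2015LogCorr, §6.1 (Assumption (A2): ξ_j = O(χ_j); [BBS-rg-pt] Lemma 6.1.2)] -/
theorem abs_xiPT_le_decay (p : ℕ) : ∃ K : ℝ, 0 < K ∧ ∀ L : ℝ, 2 ≤ L → ∀ s : ℝ, 0 < s → ∀ j : ℕ,
    |xiPT 4 L s j| ≤ K * L ^ 10 * ((1 + L ^ (2 * j) * s / (8 + s)) ^ p)⁻¹ := by
  obtain ⟨c, hc, h⟩ := abs_Gam_four_le
  obtain ⟨c₁, hc₁, h₁⟩ := abs_Gam_four_le_decay p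
  obtain ⟨c₂, hc₂, h₂⟩ := abs_latGrad_two_Gam_four_le_decay p
  obtain ⟨Kb, hKb, hb⟩ := BBS2015_A1_bounded
  refine ⟨4 * (60 * c₂ * c ^ 2 + 96 * c * c₁ ^ 2 + 16 * c₁ ^ 3) + 1 / 2 * Kb * c₁, by positivity,
    fun L hL s hs j => ?_⟩
  have hL0 : (0 : ℝ) < L := by linarith
  have hL1 : (1 : ℝ) ≤ L := by linarith
  set ϑ : ℝ := ((1 + L ^ (2 * j) * s / (8 + s)) ^ p)⁻¹ with hϑdef
  have hϑ0 : 0 < ϑ := by positivity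
  have hϑ1 : ϑ ≤ 1 := by
    rw [hϑdef]
    refine inv_le_one_of_one_le₀ (one_le_pow₀ ?_)
    have : 0 ≤ L ^ (2 * j) * s / (8 + s) := by positivity
    linarith
  have hA0 : 0 ≤ c₁ * ϑ / L ^ (2 * j) := by positivity
  have hG0 : 0 ≤ c₂ * ϑ / L ^ (4 * j) := by positivity
  have := abs_xiPT_le_core hc h hL hs.le j hA0 hG0 (fun x => h₁ L hL s hs j x)
    (fun e e' he he' x => h₂ L hL s hs j e e' he he' x) (hb L hL s hs.le j)
  refine this.trans ?_
  have e1 : L ^ (2 * (j + 1)) * (1 / 2 * (c₂ * ϑ / L ^ (4 * j)) * (40 * c ^ 2 * L ^ 6 * L ^ (2 * j))) =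
      20 * c₂ * c ^ 2 * L ^ 8 * ϑ := by
    rw [show 4 * j = 2 * j + 2 * j by ring, pow_add, show 2 * (j + 1) = 2 * j + 2 by ring, pow_add]
    field_simp
    norm_num
  have e2 : L ^ (2 * (j + 1)) * ((c₁ * ϑ / L ^ (2 * j)) ^ 2 * (32 * c * L ^ 4 * L ^ (2 * j))) =
      32 * c * c₁ ^ 2 * L ^ 6 * ϑ ^ 2 := by
    rw [show 2 * (j + 1) = 2 * j + 2 by ring, pow_add, div_pow, ← pow_mul, show 2 * j * 2 = 2 * j + 2 * j by ring,
      pow_add]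
    field_simp
  have e3 : L ^ (2 * (j + 1)) * ((c₁ * ϑ / L ^ (2 * j)) ^ 3 * (16 * L ^ 4 * L ^ (4 * j))) = 16 * c₁ ^ 3 * L ^ 6 * ϑ ^ 3 := by
    rw [show 2 * (j + 1) = 2 * j + 2 by ring, pow_add, div_pow, ← pow_mul,
      show 2 * j * 3 = 2 * j + 4 * j by ring, pow_add]
    field_simp
  have e4 : L ^ (2 * (j + 1)) * (1 / 4 * (Kb * L ^ 4) * (2 * (c₁ * ϑ / L ^ (2 * j)))) = 1 / 2 * Kb * c₁ * L ^ 6 * ϑ := by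
    rw [show 2 * (j + 1) = 2 * j + 2 by ring, pow_add]
    field_simp
    ring
  have hL6 : L ^ 6 ≤ L ^ 10 := pow_le_pow_right₀ hL1 (by norm_num)
  have hL8 : L ^ 8 ≤ L ^ 10 := pow_le_pow_right₀ hL1 (by norm_num)
  have hϑ2 : ϑ ^ 2 ≤ ϑ := pow_le_of_le_one hϑ0.le hϑ1 two_ne_zero
  have hϑ3 : ϑ ^ 3 ≤ ϑ := pow_le_of_le_one hϑ0.le hϑ1 three_ne_zero
  calc L ^ (2 * (j + 1)) * (4 * (3 * (1 / 2 * (c₂ * ϑ / L ^ (4 * j)) * (40 * c ^ 2 * L ^ 6 * L ^ (2 * j))) +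
        3 * ((c₁ * ϑ / L ^ (2 * j)) ^ 2 * (32 * c * L ^ 4 * L ^ (2 * j))) +
        (c₁ * ϑ / L ^ (2 * j)) ^ 3 * (16 * L ^ 4 * L ^ (4 * j))) + 1 / 4 * (Kb * L ^ 4) * (2 * (c₁ * ϑ / L ^ (2 * j))))
      = 4 * (3 * (20 * c₂ * c ^ 2 * L ^ 8 * ϑ) + 3 * (32 * c * c₁ ^ 2 * L ^ 6 * ϑ ^ 2) + 16 * c₁ ^ 3 * L ^ 6 * ϑ ^ 3) +
          1 / 2 * Kb * c₁ * L ^ 6 * ϑ := by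
        rw [← e1, ← e2, ← e3, ← e4]; ring
    _ ≤ 4 * (3 * (20 * c₂ * c ^ 2 * L ^ 10 * ϑ) + 3 * (32 * c * c₁ ^ 2 * L ^ 10 * ϑ) + 16 * c₁ ^ 3 * L ^ 10 * ϑ) +
          1 / 2 * Kb * c₁ * L ^ 10 * ϑ := by gcongr
    _ = (4 * (60 * c₂ * c ^ 2 + 96 * c * c₁ ^ 2 + 16 * c₁ ^ 3) + 1 / 2 * Kb * c₁) * L ^ 10 * ϑ := by ring

end CTWSAW

end Literature.Barriers.CriticalPhenomena
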